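import Summits.NavierStokesRegularity.FluidComputer.PalasekTowerRegisterGlobalDesign
import Summits.NavierStokesRegularity.FluidComputer.PalasekTowerRegisterGlobalHostSide

/-!
# REGISTER v2.3′: the design slot of the `EpisodeBaseG` split — class constructors and constraints

Cell `ns-blowup`, seat `ns-blowup-ecbridge-4` (g0), one writer of `GoodHost` by planner RULING STATUS
l.1890; companion of `PalasekTowerRegisterGlobalDesign.lean` (`HostClass`, `HostPreparationD`,
`FirstEpisodeD`, the glue `episodeBaseG_of_host_firstD`, the re-push surgery) and of
`PalasekTowerRegisterGlobalFirstHitting.lean` (p417307: the anchor's bite at `τ₀`). LABEL: E–C typing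
(KERNEL vocabulary + bookkeeping). WHAT THIS IS NOT: not Navier–Stokes evidence — no host design, stage,
push or instance is constructed or claimed; NO design class is instantiated: the tree holds no `ℝ³`
level-0 host profile yet (lean3's `PalasekObukhov/{TowerEnvelope, ShellEmbedding}` type the MODEL
tower and the abstract embedding notions; the P-TOWER / X0 words are forced ABC on `𝕋³`).

* `HostClass.nearC1 𝒰 ε₀ ε₁` — the readout state `u (τ₀)` lies within `ε₀` in sup-norm and `ε₁` in
  gradient sup-norm of SOME profile of a named family `𝒰 ⊆ (ℝ³ → ℝ³)`; `HostClass.rising κ` — at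
  every level-0 floor point the squared speed rises INTO `τ₀` at rate `≥ κ` (the register gives rate
  `≥ 0` for free, `HostClass.rising_zero`; a design says how fast its maximum grows when read);
  monotonicity (`nearC1_mono`, `rising_anti`).
* What the register forces on ANY preparable design: `HostPreparationD.design_constraints` (some
  `U ∈ 𝒰` has sup speed within `ε₀` of EXACTLY `c₁ Y₀ = 256^{13/10}` — not more — and a ball point
  with `‖DU‖ ≥ c₁ A₀ − ε₁ = 256^{23/10} − ε₁`) and `Stage.rising_budget`
  (`κ + ν |Du (τ₀, x₀)|² ≤ −⟪u, ∇p⟫ (τ₀, x₀) + c₁ c₄ Y₀²`: a rising host is pressure-driven at its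
  maximum, quantitatively).
* (The host-side corollaries of the anchor's bite and the `c₄ = 0` silence lemmas are the proof-only
  companion `PalasekTowerRegisterGlobalHostSide.lean`.)
* The filing shape of record (RULING l.1890 (2)) is then ONE LINE each, to be declared the hour a
  concrete `𝒰` exists: `GoodHost := (HostClass.nearC1 𝒰 ε₀ ε₁).inter (HostClass.rising κ)`,
  `HostPreparationH := HostPreparationD GoodHost`, `FirstEpisodeH := FirstEpisodeD GoodHost`, glue
  `episodeBaseG_of_host_firstD GoodHost`.

References: S. Palasek, arXiv:2605.13827 §3.3 [cite: Palasek2026ElementaryModel, §3.3].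
-/

noncomputable section

namespace Summit.NavierStokesRegularity.FluidComputer.PalasekTowerClayBridge

open Set MeasureTheory Filter Topology Function Real
open scoped ENNReal ContDiff NNReal InnerProductSpace RealInnerProductSpace
open Laplacian
open Literature.Analysis.FluidPDE

/-! ## The design slot: class constructors and the register's constraints on any design -/

/-- **The `C¹`-tolerance class around a named profile family** `𝒰 ⊆ (ℝ³ → ℝ³)`: the readout state
`u (τ₀)` of the host lies within `ε₀` in sup-norm and within `ε₁` in gradient sup-norm of SOME profile
`U ∈ 𝒰` (symmetries of the design = whatever `𝒰` is closed under). The intended `GoodHost` of the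
filing shape of record is `(nearC1 𝒰 ε₀ ε₁).inter (rising κ)` for a concrete `𝒰`. [folklore] -/
def HostClass.nearC1 (𝒰 : Set (EuclideanSpace ℝ (Fin 3) → EuclideanSpace ℝ (Fin 3))) (ε₀ ε₁ : ℝ) :
    HostClass :=
  fun S s₀ => ∃ U ∈ 𝒰, (∀ x, ‖s₀.u (S.τ 0) x - U x‖ ≤ ε₀) ∧
    (∀ x, ‖fderiv ℝ (s₀.u (S.τ 0)) x - fderiv ℝ U x‖ ≤ ε₁)

/-- **The rising class**: at every level-0 floor point of the host the squared speed rises INTO `τ₀`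
at rate at least `κ` — `κ ≤ ⟪u, ∂ₜu⟫ (τ₀⁻, x₀)` (one-sided derivative within the host's slab
`[0, τ₀]`); the register alone gives `0 ≤ ⟪u, ∂ₜu⟫` (`Stage.inner_timeDeriv_τ_zero_nonneg`), a design
states HOW FAST its maximum is growing when read. [folklore] -/
def HostClass.rising (κ : ℝ) : HostClass :=
  fun S s₀ => ∀ x₀, ‖x₀‖ ≤ S.radius → S.c₁ * TowerRates.wide.Y 0 ≤ ‖s₀.u (S.τ 0) x₀‖ →
    κ ≤ ⟪s₀.u (S.τ 0) x₀, timeDerivWithin (Icc 0 (S.τ 0)) s₀.u (S.τ 0) x₀⟫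

/-- Tolerance classes are monotone in the tolerances and in the family. [folklore] -/
theorem HostClass.nearC1_mono {𝒰 𝒰' : Set (EuclideanSpace ℝ (Fin 3) → EuclideanSpace ℝ (Fin 3))}
    {ε₀ ε₁ ε₀' ε₁' : ℝ} (h𝒰 : 𝒰 ⊆ 𝒰') (h₀ : ε₀ ≤ ε₀') (h₁ : ε₁ ≤ ε₁') :
    ∀ S s₀, HostClass.nearC1 𝒰 ε₀ ε₁ S s₀ → HostClass.nearC1 𝒰' ε₀' ε₁' S s₀ := by
  rintro S s₀ ⟨U, hU, hU₀, hU₁⟩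
  exact ⟨U, h𝒰 hU, fun x => (hU₀ x).trans h₀, fun x => (hU₁ x).trans h₁⟩

/-- The rising classes are antitone in the rate. [folklore] -/
theorem HostClass.rising_anti {κ κ' : ℝ} (h : κ ≤ κ') :
    ∀ S s₀, HostClass.rising κ' S s₀ → HostClass.rising κ S s₀ :=
  fun _ _ hs x₀ hx hfl => h.trans (hs x₀ hx hfl)

/-- Every registered host is rising at rate `0` (the anchor's monotone first approach,
`Stage.inner_timeDeriv_τ_zero_nonneg`): `rising κ` is a DESIGN requirement only for `κ > 0`. [folklore] -/
theorem HostClass.rising_zero : ∀ S s₀, HostClass.rising 0 S s₀ :=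
  fun _ s₀ _ _ hfl => s₀.inner_timeDeriv_τ_zero_nonneg hfl

/-- **What the register forces on any preparable design** (from the anchor's bite, p417307): if a host
can be prepared in the tolerance class of `𝒰` at all, then some profile `U ∈ 𝒰` has, up to the
tolerances, sup speed EXACTLY `c₁ Y₀` (not more: `‖U‖ ≤ c₁ Y₀ + ε₀` everywhere, `≥ c₁ Y₀ − ε₀` at a
point of the ball) and a ball point with gradient `≥ c₁ A₀ − ε₁` — on the registered constants
`c₁ = 1`, `Y₀ = 256^{13/10} ≈ 1351`, `A₀ = 256^{23/10} ≈ 3.46·10⁵`. [folklore] -/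
theorem HostPreparationD.design_constraints
    {𝒰 : Set (EuclideanSpace ℝ (Fin 3) → EuclideanSpace ℝ (Fin 3))} {ε₀ ε₁ : ℝ}
    (h : HostPreparationD (HostClass.nearC1 𝒰 ε₀ ε₁)) :
    ∃ U ∈ 𝒰, ∃ r : ℝ,
      (∀ x, ‖U x‖ ≤ TowerRates.wide.Y 0 + ε₀) ∧
      (∃ x₀, ‖x₀‖ ≤ r ∧ TowerRates.wide.Y 0 - ε₀ ≤ ‖U x₀‖) ∧
      (∃ x, ‖x‖ ≤ r ∧ TowerRates.wide.A 0 - ε₁ ≤ ‖fderiv ℝ U x‖) := by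
  obtain ⟨S, s₀, -, hR, -, U, hU, hU₀, hU₁⟩ := h
  have hc₁ : S.c₁ = 1 := hR.c₁_eq
  refine ⟨U, hU, S.radius, fun x => ?_, ?_, ?_⟩
  · have h1 := s₀.norm_τ_zero_le x
    rw [hc₁, one_mul] at h1
    have h2 := hU₀ x
    have h3 : ‖U x‖ ≤ ‖s₀.u (S.τ 0) x‖ + ‖s₀.u (S.τ 0) x - U x‖ := by
      have := norm_sub_norm_le (U x) (s₀.u (S.τ 0) x)
      rw [norm_sub_rev] at this
      linarith
    linarith
  · obtain ⟨x₀, hx₀, heq, -⟩ := s₀.exists_norm_τ_zero_eq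
    rw [hc₁, one_mul] at heq
    refine ⟨x₀, hx₀, ?_⟩
    have h2 := hU₀ x₀
    have h3 := norm_sub_norm_le (s₀.u (S.τ 0) x₀) (U x₀)
    linarith
  · obtain ⟨x, hx, hstr⟩ := s₀.routeG_strain 0 le_rfl
    rw [hc₁, one_mul] at hstr
    refine ⟨x, hx, ?_⟩
    have h2 := hU₁ x
    have h3 := norm_sub_norm_le (fderiv ℝ (s₀.u (S.τ 0)) x) (fderiv ℝ U x)
    linarith

/-- **A rising host is pressure-driven, quantitatively** (momentum equation at the floor point, p417307):
at every level-0 floor point of a host in `rising κ`,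
`κ + ν |Du (τ₀, x₀)|² ≤ −⟪u, ∇p⟫ (τ₀, x₀) + ⟪u, f (τ₀)⟫ (x₀) ≤ −⟪u, ∇p⟫ (τ₀, x₀) + c₁ c₄ Y₀²` — the
pressure gradient must do work on the maximum at rate `κ` ABOVE the local viscous loss, up to the
window force budget (here `ν = 1`). [cite: Palasek2026ElementaryModel, §3.3] -/
theorem Stage.rising_budget {S : Schedule TowerRates.wide} {κ : ℝ}
    (s₀ : Stage 1 TowerRates.wide S (Margins.routeG TowerRates.wide) 0)
    (hs : HostClass.rising κ S s₀) {x₀ : EuclideanSpace ℝ (Fin 3)} (hx₀ : ‖x₀‖ ≤ S.radius)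
    (hfl : S.c₁ * TowerRates.wide.Y 0 ≤ ‖s₀.u (S.τ 0) x₀‖) :
    κ + frobeniusNormSq (fderiv ℝ (s₀.u (S.τ 0)) x₀) ≤
      -⟪s₀.u (S.τ 0) x₀, gradient (s₀.p (S.τ 0)) x₀⟫ + S.c₁ * S.c₄ * TowerRates.wide.Y 0 ^ 2 := by
  have hκ := hs x₀ hx₀ hfl
  have hmom := s₀.classical.momentum (S.τ 0) s₀.τ_zero_mem_Icc x₀
  have hD : timeDerivWithin (Icc 0 (S.τ 0)) s₀.u (S.τ 0) x₀ =
      (1 : ℝ) • (Δ (s₀.u (S.τ 0))) x₀ - gradient (s₀.p (S.τ 0)) x₀ + S.f (S.τ 0) x₀ -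
        convect (s₀.u (S.τ 0)) (s₀.u (S.τ 0)) x₀ := by
    rw [← hmom]; abel
  rw [hD, inner_sub_right, inner_add_right, inner_sub_right, real_inner_smul_right,
    s₀.inner_convect_τ_zero_eq_zero hfl] at hκ
  have h2 := s₀.inner_laplacian_τ_zero_le hfl
  have h3 := s₀.inner_force_τ_zero_le hfl
  linarith

/-- **… and the core ledger transfers to the design up to `ε₀ · 8π / N₀`**: if a host can be prepared
in the tolerance class of a family `𝒰` of CONTINUOUS profiles, some `U ∈ 𝒰` carries circulation
`≥ c₁ N₀^{β-2} − ε₀ · 8π/N₀` (`= 256^{3/10} − ε₀ · 8π/256 ≈ 5.28 − 0.098 ε₀`) around a `C¹` loop of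
speed `≤ 8π/N₀` inside a ball of radius `1/N₀` centred in the tower's ball
(`|∮_γ (u − U) · dl| ≤ sup ‖u − U‖ · length`). [folklore] -/
theorem HostPreparationD.design_constraints_core
    {𝒰 : Set (EuclideanSpace ℝ (Fin 3) → EuclideanSpace ℝ (Fin 3))} {ε₀ ε₁ : ℝ}
    (h𝒰 : ∀ U ∈ 𝒰, Continuous U) (h : HostPreparationD (HostClass.nearC1 𝒰 ε₀ ε₁)) :
    ∃ U ∈ 𝒰, ∃ r : ℝ, ∃ (x : EuclideanSpace ℝ (Fin 3)) (γ : ℝ → EuclideanSpace ℝ (Fin 3)),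
      ‖x‖ ≤ r ∧ ContDiff ℝ 1 γ ∧ γ 0 = γ 1 ∧
      (∀ σ ∈ Icc (0 : ℝ) 1, γ σ ∈ Metric.closedBall x (1 / TowerRates.wide.N 0)) ∧
      (∀ σ ∈ Icc (0 : ℝ) 1, ‖deriv γ σ‖ ≤ 8 * π / TowerRates.wide.N 0) ∧
      TowerRates.wide.N 0 ^ (TowerRates.wide.β - 2) - ε₀ * (8 * π / TowerRates.wide.N 0) ≤
        circulation U γ := by
  obtain ⟨S, s₀, -, hR, -, U, hU, hU₀, -⟩ := h
  obtain ⟨x, γ, hx, hγ, hloop, hball, hspeed, hcirc⟩ := s₀.routeG_coreLedger 0 le_rfl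
  rw [hR.c₁_eq, one_mul] at hcirc
  refine ⟨U, hU, S.radius, x, γ, hx, hγ, hloop, hball, hspeed, ?_⟩
  have hγc : Continuous γ := hγ.continuous
  have hγ'c : Continuous (deriv γ) := hγ.continuous_deriv le_rfl
  have huc : Continuous (s₀.u (S.τ 0)) := s₀.contDiff_u_τ_zero.continuous
  have hUc : Continuous U := h𝒰 U hU
  have hFi : IntervalIntegrable (fun s => ⟪s₀.u (S.τ 0) (γ s), deriv γ s⟫) volume 0 1 :=
    ((huc.comp hγc).inner hγ'c).intervalIntegrable 0 1
  have hGi : IntervalIntegrable (fun s => ⟪U (γ s), deriv γ s⟫) volume 0 1 :=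
    ((hUc.comp hγc).inner hγ'c).intervalIntegrable 0 1
  have hsub : circulation (s₀.u (S.τ 0)) γ - circulation U γ =
      ∫ s in (0 : ℝ)..1, ⟪s₀.u (S.τ 0) (γ s) - U (γ s), deriv γ s⟫ := by
    rw [circulation, circulation, ← intervalIntegral.integral_sub hFi hGi]
    congr 1
    funext s
    rw [inner_sub_left]
  have hbound : ‖∫ s in (0 : ℝ)..1, ⟪s₀.u (S.τ 0) (γ s) - U (γ s), deriv γ s⟫‖ ≤
      ε₀ * (8 * π / TowerRates.wide.N 0) * |1 - 0| := by
    refine intervalIntegral.norm_integral_le_of_norm_le_const fun s hs => ?_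
    have hs' : s ∈ Icc (0 : ℝ) 1 := by
      rw [Set.uIoc_of_le zero_le_one] at hs
      exact ⟨hs.1.le, hs.2⟩
    rw [Real.norm_eq_abs]
    calc |⟪s₀.u (S.τ 0) (γ s) - U (γ s), deriv γ s⟫|
        ≤ ‖s₀.u (S.τ 0) (γ s) - U (γ s)‖ * ‖deriv γ s‖ := abs_real_inner_le_norm _ _
      _ ≤ ε₀ * (8 * π / TowerRates.wide.N 0) :=
          mul_le_mul (hU₀ (γ s)) (hspeed s hs') (norm_nonneg _)
            ((norm_nonneg _).trans (hU₀ (γ s)))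
  rw [← hsub, Real.norm_eq_abs, sub_zero, abs_one, mul_one] at hbound
  have h3 := le_abs_self (circulation (s₀.u (S.τ 0)) γ - circulation U γ)
  linarith

end Summit.NavierStokesRegularity.FluidComputer.PalasekTowerClayBridge

end
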